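import Summits.KontsevichZagierPeriods.KontsevichZagierPeriods.Theorems.BetaCancellation.Negative.KernelForm
import Literature.NumberTheory.Transcendental.KZRelationsLE

/-!
# `TriplicationFromMultiplication` (stmt-KontsevichZagierPeriods-13693) — part 3: product algebra
modulo the moves

Helper file for the cancellation glue of route TerasomaMultiplication: the bookkeeping of products
`KZ.IntegralRep.prod` modulo `KZ.relations` that the ring derivation uses — commutativity and
associativity up to equivalence (coordinate relabellings, `KZ.of_sub_of_reindex_mem_relations`),
congruence in right-nested products ("lists" `a × (b × (c × …))`: combine or swap the first two
factors), algebraic scalars (`KZ.IntegralRep.constMul`) pulled through products and moved across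
equivalences, and
the unit `[(0,1), 1] × r ∼ r` (`BetaCancellationNegative.equivalent_of_isPinned_one`).
All statements are dimension-heterogeneous `KZ.Equivalent`s, so no arithmetic of dimensions is needed.
-/

noncomputable section

open MeasureTheory Set
open scoped BigOperators

namespace Summit.KontsevichZagierPeriods.TerasomaMultiplication.TriplicationGlue

open Literature.NumberTheory.Transcendental
open Literature.NumberTheory.Transcendental.KZ
open Summit.KontsevichZagierPeriods.KontsevichZagierPeriods.BetaCancellationNegative
  (polyKernelRep isPinned_one_prod equivalent_of_isPinned_one betaKernel_one_one)

variable {l m n l' m' n' : ℕ}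

/-! ## Commutativity and associativity of `prod` modulo relations -/

/-- **`r × s ∼ s × r`** (the block flip is a relabelling move). [folklore] -/
theorem prod_comm (r : IntegralRep n) (s : IntegralRep m) : Equivalent (r.prod s) (s.prod r) := by
  have h := of_sub_of_reindex_mem_relations (s.prod r) finAddFlip
  rw [← IntegralRep.prod_eq_reindex_prod r s] at h
  exact Equivalent.symm h

/-- **`t × (s × r) ∼ (t × s) × r`** (a relabelling move along `finCongr (Nat.add_assoc _ _ _)`).
[folklore] -/
theorem prod_assoc (t : IntegralRep l) (s : IntegralRep m) (r : IntegralRep n) :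
    Equivalent (t.prod (s.prod r)) ((t.prod s).prod r) := by
  let e : Fin (l + m + n) ≃ Fin (l + (m + n)) := finCongr (Nat.add_assoc l m n)
  have key : t.prod (s.prod r) = ((t.prod s).prod r).reindex e := by
    have h1 : ∀ (w : Fin (l + (m + n)) → ℝ) (i : Fin l),
        w (e (Fin.castAdd n (Fin.castAdd m i))) = w (Fin.castAdd (m + n) i) := by
      intro w i; congr 1
    have h2 : ∀ (w : Fin (l + (m + n)) → ℝ) (j : Fin m),
        w (e (Fin.castAdd n (Fin.natAdd l j))) = w (Fin.natAdd l (Fin.castAdd n j)) := by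
      intro w j; congr 1
    have h3 : ∀ (w : Fin (l + (m + n)) → ℝ) (j : Fin n),
        w (e (Fin.natAdd (l + m) j)) = w (Fin.natAdd l (Fin.natAdd m j)) := by
      intro w j; congr 1; ext; simp [e, Nat.add_assoc]
    refine IntegralRep.ext' ?_ ?_
    · ext w
      simp only [IntegralRep.prod_domain, IntegralRep.mem_prodDomain, IntegralRep.reindex_domain,
        mem_setOf_eq, h1, h2, h3]
      exact and_assoc.symm
    · rw [IntegralRep.reindex_integrand, IntegralRep.prod_integrand_eq, IntegralRep.prod_integrand_eq]
      funext w
      simp only [IntegralRep.prodFun, IntegralRep.prod_integrand_eq, h1, h2, h3, mul_assoc]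
  rw [key]
  exact Equivalent.symm (of_sub_of_reindex_mem_relations ((t.prod s).prod r) e)

/-! ## Right-nested products -/

/-- Congruence in the tail of a product. [folklore] -/
theorem prod_congr_right (a : IntegralRep l) {T : IntegralRep n} {T' : IntegralRep n'} (h : Equivalent T T') :
    Equivalent (a.prod T) (a.prod T') :=
  Equivalent.prod (Equivalent.refl a) h

/-- Congruence in the head of a product. [folklore] -/
theorem prod_congr_left {a : IntegralRep l} {a' : IntegralRep l'} (h : Equivalent a a') (T : IntegralRep n) :
    Equivalent (a.prod T) (a'.prod T) :=
  Equivalent.prod h (Equivalent.refl T)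

/-- **Combine the first two factors** of a right-nested product: if `a × b ∼ a' × b'` then
`a × (b × T) ∼ a' × (b' × T)`. [folklore] -/
theorem combine12 {a : IntegralRep l} {b : IntegralRep m} {a' : IntegralRep l'} {b' : IntegralRep m'}
    (T : IntegralRep n) (h : Equivalent (a.prod b) (a'.prod b')) :
    Equivalent (a.prod (b.prod T)) (a'.prod (b'.prod T)) :=
  ((prod_assoc a b T).trans (prod_congr_left h T)).trans (prod_assoc a' b' T).symm

/-- **Swap the first two factors** of a right-nested product: `a × (b × T) ∼ b × (a × T)`. [folklore] -/
theorem swap12 (a : IntegralRep l) (b : IntegralRep m) (T : IntegralRep n) :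
    Equivalent (a.prod (b.prod T)) (b.prod (a.prod T)) :=
  ((prod_assoc a b T).trans (prod_congr_left (prod_comm a b) T)).trans (prod_assoc b a T).symm

/-! ## Algebraic scalars -/

/-- Scaling the first factor of a product scales the product. [folklore] -/
theorem constMul_prod_eq (t : IntegralRep l) (r : IntegralRep n) {c : ℝ} (hc : IsAlgebraic ℚ c) :
    (t.constMul c hc).prod r = (t.prod r).constMul c hc := by
  refine IntegralRep.ext' rfl ?_
  rw [IntegralRep.prod_integrand_eq, IntegralRep.integrand_constMul, IntegralRep.prod_integrand_eq]
  funext z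
  simp only [IntegralRep.prodFun, IntegralRep.integrand_constMul, mul_assoc]

/-- Scaling the second factor of a product scales the product. [folklore] -/
theorem prod_constMul_eq (t : IntegralRep l) (r : IntegralRep n) {c : ℝ} (hc : IsAlgebraic ℚ c) :
    t.prod (r.constMul c hc) = (t.prod r).constMul c hc := by
  refine IntegralRep.ext' rfl ?_
  rw [IntegralRep.prod_integrand_eq, IntegralRep.integrand_constMul, IntegralRep.prod_integrand_eq]
  funext z
  simp only [IntegralRep.prodFun, IntegralRep.integrand_constMul]
  ring

/-- Two successive scalings. [folklore] -/
theorem constMul_constMul_eq (r : IntegralRep n) {a b : ℝ} (ha : IsAlgebraic ℚ a) (hb : IsAlgebraic ℚ b) :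
    (r.constMul a ha).constMul b hb = r.constMul (b * a) (hb.mul ha) := by
  refine IntegralRep.ext' rfl ?_
  funext x
  simp only [IntegralRep.integrand_constMul, mul_assoc]

/-- Scaling by `1`. [folklore] -/
theorem constMul_one_eq (r : IntegralRep n) (h1 : IsAlgebraic ℚ (1:ℝ)) : r.constMul 1 h1 = r := by
  refine IntegralRep.ext' rfl ?_
  funext x
  simp only [IntegralRep.integrand_constMul, one_mul]

/-- Scalings by equal constants are equal (the algebraicity proofs are irrelevant). [folklore] -/
theorem constMul_congr (r : IntegralRep n) {a b : ℝ} (ha : IsAlgebraic ℚ a) (hb : IsAlgebraic ℚ b) (h : a = b) :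
    r.constMul a ha = r.constMul b hb := by
  subst h
  rfl

/-- Moving a scalar from one side of an equivalence to the other: `c·r ∼ r' → r ∼ c⁻¹·r'`. [folklore] -/
theorem equivalent_constMul_inv_of {r : IntegralRep n} {r' : IntegralRep m} {c : ℝ} (hc : IsAlgebraic ℚ c)
    (hc0 : c ≠ 0) (h : Equivalent (r.constMul c hc) r') : Equivalent r (r'.constMul c⁻¹ hc.inv) := by
  have h' := h.constMul c⁻¹ hc.inv
  rwa [constMul_constMul_eq, constMul_congr r _ isAlgebraic_one (inv_mul_cancel₀ hc0), constMul_one_eq] at h'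

/-! ## The unit `[(0,1), 1]` -/

/-- **`[(0,1), 1] × r ∼ r`** (the unit slab over `r`: one Newton–Leibniz move with primitive `t`,
one coordinate rotation, a null boundary — `BetaCancellationNegative.equivalent_of_isPinned_one`).
[folklore] -/
theorem unit_prod (r : IntegralRep n) : Equivalent ((polyKernelRep 1).prod r) r := by
  have h := isPinned_one_prod r
  rw [betaKernel_one_one] at h
  exact equivalent_of_isPinned_one h

/-- **`[(0,1), c] × r ∼ c·r`** for an algebraic constant `c`. [folklore] -/
theorem const_unit_prod (r : IntegralRep n) {c : ℝ} (hc : IsAlgebraic ℚ c) :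
    Equivalent (((polyKernelRep 1).constMul c hc).prod r) (r.constMul c hc) := by
  rw [constMul_prod_eq]
  exact (unit_prod r).constMul c hc

end Summit.KontsevichZagierPeriods.TerasomaMultiplication.TriplicationGlue
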